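import Summits.QuantumFields.YangMills.Theorems.BalabanUVNodesN15PerCubeGreenTwoGridKnitDefectReg335LipSmall
import HarnessLib

/-!
# N15 = NE2, road (c) — PROGRAMME (PC), (PC-E): THE RATE — from ONE `Reg335LipCube` datum per cube and ONE smallness condition, the two-grid η-defect of the glued scalar covariant
# Green's functions is `≤ D·(1 + κ_e|m|·R(C, C₁, ξ, d))·L^{−k∕4}·e^{−(δ∕16)dist}` — the chain's printed-shape rate with NO fit parameter and NO `o_B` (dag-n15-c g33, n15-c∕364)

Cell `pub-ymgap`, seat `pub-ymgap-dag-n15-c` (generation g33; R134 (a) seat, strategy s1 «first missing estimate»; HUMAN RULING D-0062; chair R424 venue).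
`bears_on: R4∕N15 · K3⁸ SpineGivenEndpointR13SepCoPHV (stmt-QuantumFields-27366)`; filed `--kind proof --supports stmt-QuantumFields-27366 --as helper` — COUNT-NEUTRAL.
TWO theorems, 0 `def`, 0 `sorry`: `divergenceFit_bookkeeping` (pure real algebra: the explicit `o_B^{expl}` of n15-c∕358 is `≤ κ_e|m|·η·R` with
`R = (2(d+1)+4)((C₁∕ξ³)+(C∕ξ²)²)e^{5C∕ξ} + 2(d+1)(C∕ξ²)²e^{2C∕ξ} + 8(C∕ξ)(C∕ξ²)e^{2C∕ξ}`, using `n_f²η′³ = η′`, `n_c²N³η′³ = η`, `(N+1)η′ ≤ 2η`, `η′ ≤ η ≤ 1`) and ★★★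
`uN_idef_scGreen_tr_of_reg335Lip_rate` (n15-c∕363 `…_small_explicit` + `η = L^{−k} ≤ L^{−k∕4}` (355's `inv_le_rpow_neg_quarter`) + `HasMaj.mono`).  Imports BY NAME n15-c∕363; nothing in
the tree is modified, no landed name re-declared.

WHAT THE (PC-E-A) CHAIN SAYS, FINAL FORM (n15-c∕339–364; MODEL two-grid setting of record: King tori `M L k m`, coarse field = straight fine holonomy, per-cube gauges, trace-form colour
coordinates `e`).  ∃ `δ, c₀ > 0`, `w₀`, `D ≥ 0` (depending on `d, L, a₀, ι` only) such that for every `k, r ≥ 1`, `L^{m_v} ≥ w₀`, every unitary-group valued fine bond field `U′` carrying on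
each cube's radius-5 collar ONE datum `Reg335LipCube … ξ C C₁` ((3.35) of [B9] + the Lipschitz clause of [B11] Thm 1 (9), own constant) with `(1 + κ_e2√|m|√|m|)²(C∕ξ + C∕ξ²) ≤ c₀`,
there are unitary cube gauges in which the two-grid η-defect of the glued scalar covariant Green's functions is `≤ D(1 + κ_e|m|R(C,C₁,ξ,d))·L^{−k∕4}·e^{−(δ∕16)dist}` — NO displayed
two-grid input, NO fit parameter.

HONEST FRAMING ∕ LIMITS.  Bookkeeping; the datum is a HYPOTHESIS (production = node N04: [Balaban1985RegularSpaces] Thm 2 ∕ [Balaban1985Variational] Thm 1; the series' proofs give the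
Hölder exponent `β < 1`, entering through an `η`-dependent `C₁ ∝ (ξ∕η′)^{1−β}`, for which `R` grows like `L^{r(1−β)}η^{β−1}` and the bound stays `o(1)·L^{0}` only as
`O(L^{r(1−β)}η^β)` — recorded, not hidden; the `β = 1` endpoint is printed in (9) but not delivered by the series' proofs, cell GAPS C-B8-18); nothing of [B9]∕[B11] asserted.  NE2⁺ NOT
PRINTED ∕ NOT proved; N15 of record untouched (DISCHARGED AS CONSUMED, p687738); K3⁸ OPEN; counts of record UNMOVED (typed 28∕28 · discharged 8∕27); one finite 𝕋⁴ at fixed ε per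
index — NOT infinite volume, NOT OS on ℝ⁴, NOT a mass gap, NOT Clay.  Restate-immune (no Theses import).
-/

set_option autoImplicit false

noncomputable section

open scoped BigOperators Matrix Matrix.Norms.L2Operator
open Finset

namespace Summit.QuantumFields.YangMills.BalabanUVNodes.N15.Gluing

open Real
open Literature.MathematicalPhysics.QuantumFieldTheory.Balaban1983to89
open Literature.MathematicalPhysics.QuantumFieldTheory.Balaban1983to89.B5Prop11Plancherel (Tor fine unitVec)
open Literature.MathematicalPhysics.QuantumFieldTheory.Balaban1983to89.B11SectG (BlockNorm HasMaj)
open Literature.MathematicalPhysics.QuantumFieldTheory.Balaban1983to89.T4EtaRateDefect (idef)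
open Literature.MathematicalPhysics.QuantumFieldTheory.Balaban1983to89.B6UnitTorusCarrier (unitTorusGeo)
open Summit.QuantumFields.YangMills.BalabanUVNodes.N15.CurvedSpecies (Reg335LipCube)
open Literature.MathematicalPhysics.QuantumFieldTheory.King1986 (aK)
open Literature.Barriers.QuantumFields (traceForm)
open Summit.QuantumFields.YangMills.BalabanUVNodes.N15.VectorPiece (kingPr)
open Summit.QuantumFields.YangMills.BalabanUVNodes.N15.MatrixSpecies (coordMat basisConst basisConst_nonneg liftBlk liftMap)
open Summit.QuantumFields.YangMills.BalabanUVNodes.N15.CovAvg (mprod kingSec ctauS)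

variable {d : ℕ}

/-! ## §1 Real bookkeeping -/

/-- REAL BOOKKEEPING: the explicit divergence fit `o_B^{expl}` of n15-c∕358 (letters `p = (C∕ξ)e^{η′C∕ξ}`, `q = (C∕ξ²)e^{η′C∕ξ}`, `c = ((C₁∕ξ³)+η′(C∕ξ²)²)e^{5η′C∕ξ}`, `n_f = N·n_c`,
`η = n_c⁻¹`, `η′ = n_f⁻¹`, `N ≥ 1`, `n_c ≥ 1`) is at most `κ·|m|·η·R(C, C₁, ξ, d)` with `R = (2(d+1)+4)((C₁∕ξ³)+(C∕ξ²)²)e^{5C∕ξ} + 2(d+1)(C∕ξ²)²e^{2C∕ξ} + 8(C∕ξ)(C∕ξ²)e^{2C∕ξ}`. [folklore] -/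
theorem divergenceFit_bookkeeping (κ m dd N Nm1 nc nf η η' p q c C C₁ ξ : ℝ) (hκ : 0 ≤ κ) (hm : 0 ≤ m) (hdd : 0 ≤ dd) (hN1 : 1 ≤ N) (hNm1 : Nm1 ≤ N)
    (hnc1 : 1 ≤ nc) (hnf : nf = N * nc) (hη : η = nc⁻¹) (hη' : η' = nf⁻¹) (hξ : 0 < ξ) (hC : 0 ≤ C) (hC₁ : 0 ≤ C₁)
    (hp : p = (C / ξ) * Real.exp (η' * (C / ξ))) (hq : q = (C / ξ ^ 2) * Real.exp (η' * (C / ξ))) (hc : c = ((C₁ / ξ ^ 3) + η' * (C / ξ ^ 2) ^ 2) * Real.exp (5 * (η' * (C / ξ)))) :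
    κ * (nf ^ 2 * (dd * (Nm1 * (m * (2 * (η' ^ 3 * c) + η' ^ 2 * q * (η' ^ 2 * q) + η' ^ 2 * q * (η' ^ 2 * q))))) +
        m * (4 * nc ^ 2 * N ^ 3 * (η' * p * (η' ^ 2 * q) + η' ^ 3 * c) + 2 * (N * nc) ^ 2 * ((N + 1) * (η' * p) * (η' ^ 2 * q)))) ≤
      κ * m * η * ((2 * dd + 4) * (((C₁ / ξ ^ 3) + (C / ξ ^ 2) ^ 2) * Real.exp (5 * (C / ξ))) + 2 * dd * ((C / ξ ^ 2) ^ 2 * Real.exp (2 * (C / ξ))) + 8 * ((C / ξ) * (C / ξ ^ 2) * Real.exp (2 * (C / ξ)))) := by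
  have hN0 : 0 < N := by linarith
  have hnc0 : 0 < nc := by linarith
  have hnf0 : 0 < nf := by rw [hnf]; positivity
  have hη0 : 0 < η := by rw [hη]; positivity
  have hη'0 : 0 < η' := by rw [hη']; positivity
  have hη1 : η ≤ 1 := by rw [hη]; exact inv_le_one_of_one_le₀ hnc1
  have hnf1 : 1 ≤ nf := by rw [hnf]; exact one_le_mul_of_one_le_of_one_le hN1 hnc1
  have hη'1 : η' ≤ 1 := by rw [hη']; exact inv_le_one_of_one_le₀ hnf1
  have hη'η : η' ≤ η := by rw [hη', hη]; exact inv_anti₀ hnc0 (by rw [hnf]; exact le_mul_of_one_le_left hnc0.le hN1)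
  have hNη' : N * η' = η := by rw [hη', hη, hnf, mul_inv, ← mul_assoc, mul_inv_cancel₀ hN0.ne', one_mul]
  have hCξ : 0 ≤ C / ξ := div_nonneg hC hξ.le
  -- step 1: the algebra of the scalings
  have hid : κ * (nf ^ 2 * (dd * (Nm1 * (m * (2 * (η' ^ 3 * c) + η' ^ 2 * q * (η' ^ 2 * q) + η' ^ 2 * q * (η' ^ 2 * q))))) +
        m * (4 * nc ^ 2 * N ^ 3 * (η' * p * (η' ^ 2 * q) + η' ^ 3 * c) + 2 * (N * nc) ^ 2 * ((N + 1) * (η' * p) * (η' ^ 2 * q)))) =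
      κ * m * ((dd * (Nm1 * η')) * (2 * c + 2 * (η' * q ^ 2)) + (4 * η * (p * q + c) + 2 * (η + η') * (p * q))) := by
    rw [hη', hη, hnf]
    field_simp
    ring
  rw [hid]
  -- step 2: the sizes of the letters
  have hηC : η' * (C / ξ) ≤ C / ξ := mul_le_of_le_one_left hCξ hη'1
  have hexp5 : Real.exp (5 * (η' * (C / ξ))) ≤ Real.exp (5 * (C / ξ)) := Real.exp_le_exp.mpr (by linarith)
  have hCξ2 : 0 ≤ C / ξ ^ 2 := by positivity
  have hCξ3 : 0 ≤ C₁ / ξ ^ 3 := by positivity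
  have hp0 : 0 ≤ p := by rw [hp]; positivity
  have hq0 : 0 ≤ q := by rw [hq]; positivity
  have hc0 : 0 ≤ c := by rw [hc]; positivity
  have hcle : c ≤ ((C₁ / ξ ^ 3) + (C / ξ ^ 2) ^ 2) * Real.exp (5 * (C / ξ)) := by
    rw [hc]
    exact mul_le_mul (by nlinarith only [hη'1, sq_nonneg (C / ξ ^ 2)]) hexp5 (Real.exp_pos _).le (by positivity)
  have hE2 : Real.exp (η' * (C / ξ)) * Real.exp (η' * (C / ξ)) ≤ Real.exp (2 * (C / ξ)) := by
    rw [← Real.exp_add]; exact Real.exp_le_exp.mpr (by linarith)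
  have hq2 : q ^ 2 ≤ (C / ξ ^ 2) ^ 2 * Real.exp (2 * (C / ξ)) := by
    rw [hq]; calc ((C / ξ ^ 2) * Real.exp (η' * (C / ξ))) ^ 2 = (C / ξ ^ 2) ^ 2 * (Real.exp (η' * (C / ξ)) * Real.exp (η' * (C / ξ))) := by ring
      _ ≤ _ := mul_le_mul_of_nonneg_left hE2 (by positivity)
  have hpq : p * q ≤ (C / ξ) * (C / ξ ^ 2) * Real.exp (2 * (C / ξ)) := by
    rw [hp, hq]; calc (C / ξ) * Real.exp (η' * (C / ξ)) * ((C / ξ ^ 2) * Real.exp (η' * (C / ξ))) = (C / ξ) * (C / ξ ^ 2) * (Real.exp (η' * (C / ξ)) * Real.exp (η' * (C / ξ))) := by ring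
      _ ≤ _ := mul_le_mul_of_nonneg_left hE2 (by positivity)
  have hη'q2 : η' * q ^ 2 ≤ (C / ξ ^ 2) ^ 2 * Real.exp (2 * (C / ξ)) := (mul_le_of_le_one_left (sq_nonneg _) hη'1).trans hq2
  have hNm1η' : Nm1 * η' ≤ η := (mul_le_mul_of_nonneg_right hNm1 hη'0.le).trans hNη'.le
  -- step 3: assemble
  have hκm : 0 ≤ κ * m := mul_nonneg hκ hm
  set R₁ := ((C₁ / ξ ^ 3) + (C / ξ ^ 2) ^ 2) * Real.exp (5 * (C / ξ))
  set R₂ := (C / ξ ^ 2) ^ 2 * Real.exp (2 * (C / ξ))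
  set R₃ := (C / ξ) * (C / ξ ^ 2) * Real.exp (2 * (C / ξ))
  have hR10 : 0 ≤ R₁ := by positivity
  have h1 : dd * (Nm1 * η') * (2 * c + 2 * (η' * q ^ 2)) ≤ dd * η * (2 * R₁ + 2 * R₂) :=
    mul_le_mul (mul_le_mul_of_nonneg_left hNm1η' hdd) (by linarith) (by positivity) (by positivity)
  have h2 : 4 * η * (p * q + c) ≤ 4 * η * (R₃ + R₁) := mul_le_mul_of_nonneg_left (add_le_add hpq hcle) (by positivity)
  have h3 : 2 * (η + η') * (p * q) ≤ 4 * η * R₃ := by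
    have h3a : 2 * (η + η') ≤ 4 * η := by linarith
    calc 2 * (η + η') * (p * q) ≤ 4 * η * (p * q) := mul_le_mul_of_nonneg_right h3a (mul_nonneg hp0 hq0)
      _ ≤ 4 * η * R₃ := mul_le_mul_of_nonneg_left hpq (by positivity)
  calc κ * m * (dd * (Nm1 * η') * (2 * c + 2 * (η' * q ^ 2)) + (4 * η * (p * q + c) + 2 * (η + η') * (p * q)))
      ≤ κ * m * (dd * η * (2 * R₁ + 2 * R₂) + (4 * η * (R₃ + R₁) + 4 * η * R₃)) := mul_le_mul_of_nonneg_left (add_le_add h1 (add_le_add h2 h3)) hκm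
    _ = κ * m * η * ((2 * dd + 4) * R₁ + 2 * dd * R₂ + 8 * R₃) := by ring

/-! ## §2 The rate -/

section Rate

variable {L : ℕ} [NeZero L]

set_option maxHeartbeats 800000 in
/-- ★★★ **THE (PC-E-A) CHAIN's RATE WITH NO FIT PARAMETER** — see the module docstring. [cite: Balaban1985BackgroundPropagators, (3.35) p.396, (3.40) p.397, (3.51)–(3.52) p.400 (shapes);
Balaban1985Variational, Thm 1 (9) p.279 (the per-cube Hölder clause); King1986, p.664 (pairing)] -/
theorem uN_idef_scGreen_tr_of_reg335Lip_rate (hL : Odd L ∧ 1 < L) (hL7 : 7 ≤ L) {a₀ : ℝ} (ha₀ : 0 < a₀) (ι : Type) [Fintype ι] [DecidableEq ι] :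
    ∃ δ w₀ c₀ D : ℝ, 0 < δ ∧ 0 < c₀ ∧ 0 ≤ D ∧ ∀ (mv kk r : ℕ), 1 ≤ kk → 1 ≤ r → w₀ ≤ ((L ^ mv : ℕ) : ℝ) →
      ∀ {mm : Type} [Fintype mm] [DecidableEq mm] [Nonempty mm] (e : Matrix mm mm ℂ ≃L[ℝ] (ι → ℝ)), (∀ A B : Matrix mm mm ℂ, traceForm A B = e A ⬝ᵥ e B) →
      ∀ (U' : Fin (d + 1) → ScX' d L mv kk r hL → (Matrix mm mm ℂ)ˣ), (∀ μ x', (U' μ x' : Matrix mm mm ℂ) ∈ Matrix.unitaryGroup mm ℂ) →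
      ∀ (Q : (Fin (d + 1) → ZMod (2 * L)) → Set (ScX' d L mv kk r hL)) (ξ C C₁ : ℝ), 0 < ξ → 0 ≤ C → 0 ≤ C₁ →
        (1 + @basisConst ι _ (Matrix mm mm ℂ) Matrix.frobeniusNormedAddCommGroup Matrix.frobeniusNormedSpace e * (2 * Real.sqrt (Fintype.card mm)) * Real.sqrt (Fintype.card mm)) ^ 2 * (C / ξ + C / ξ ^ 2) ≤ c₀ →
        (∀ k, Reg335LipCube (scShift' d L mv kk r hL) U' ((((L ^ r * L ^ kk : ℕ) : ℝ))⁻¹) (Q k) ξ C C₁) →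
        (∀ k z, (∃ y ∈ cvSk d L mv kk hL k, (unitTorusGeo L kk (cvM d L mv kk hL)).dist (scBlk' d L mv kk r hL z) y ≤ 5) → z ∈ Q k) →
      ∃ u' : (Fin (d + 1) → ZMod (2 * L)) → ScX' d L mv kk r hL → Matrix mm mm ℂ, (∀ k x', (u' k x')ᴴ * u' k x' = 1) ∧
       (
        HasMaj (ScNorm d L mv kk hL ι) (BlockNorm.ofBlocks (unitTorusGeo L kk (cvM d L mv kk hL)) (liftBlk (scBlk d L mv kk hL ∘ kingPr L kk r (cvM d L mv kk hL)) ι))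
          (idef (ctauS (cvM d L mv kk hL) L kk r (fun μ x' => coordMat e (ContinuousLinearMap.mulLeftRight ℝ (Matrix mm mm ℂ) ((U' μ x' : Matrix mm mm ℂ)) ((U' μ x' : Matrix mm mm ℂ))ᴴ))) (ctauS (cvM d L mv kk hL) L kk r (fun μ x' => coordMat e (ContinuousLinearMap.mulLeftRight ℝ (Matrix mm mm ℂ) ((U' μ x' : Matrix mm mm ℂ)) ((U' μ x' : Matrix mm mm ℂ))ᴴ))) (scGlued' d L mv kk r hL (aK a₀ (L : ℝ) (r + kk) * (((L ^ r * L ^ kk : ℕ) : ℝ)) ^ (d + 1)) ((((L ^ r * L ^ kk : ℕ) : ℝ))⁻¹) ι e u' (fun μ z => (U' μ z : Matrix mm mm ℂ)) (scP' d L mv kk r hL (aK a₀ (L : ℝ) (r + kk) * (((L ^ r * L ^ kk : ℕ) : ℝ)) ^ (d + 1)) ι e (fun μ z => (U' μ z : Matrix mm mm ℂ))) (scNV' d L mv kk r hL (aK a₀ (L : ℝ) (r + kk) * (((L ^ r * L ^ kk : ℕ) : ℝ)) ^ (d + 1)) ι e u' (fun μ z => (U' μ z : Matrix mm mm ℂ))))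 (scGlued d L mv kk hL (aK a₀ (L : ℝ) kk * (((L ^ kk : ℕ) : ℝ)) ^ (d + 1)) ((((L ^ kk : ℕ) : ℝ))⁻¹) ι e (fun k x => u' k (kingSec (cvM d L mv kk hL) L kk r x)) (fun μ y => mprod (fun t => (U' μ (kingSec (cvM d L mv kk hL) L kk r y + t • unitVec (fine (L ^ r * L ^ kk) (cvM d L mv kk hL)) μ) : Matrix mm mm ℂ)) (L ^ r)) (scP d L mv kk hL (aK a₀ (L : ℝ) kk * (((L ^ kk : ℕ) : ℝ)) ^ (d + 1)) ι e (fun μ y => mprod (fun t => (U' μ (kingSec (cvM d L mv kk hL) L kk r y + t • unitVec (fine (L ^ r * L ^ kk) (cvM d L mv kk hL)) μ) : Matrix mm mm ℂ)) (L ^ r))) (scNV d L mv kk hL (aK a₀ (L : ℝ) kk * (((L ^ kk : ℕ) : ℝ)) ^ (d + 1)) ι e (fun k x => u' k (kingSec (cvM d L mv kk hL) L kk r x)) (fun μ y => mprod (fun t => (U' μ (kingSec (cvM d L mv kk hL) L kk r y + t • unitVec (fine (L ^ r * L ^ kk) (cvM d L mv kk hL)) μ) : Matrix mm mm ℂ))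 (L ^ r)))))
          (fun y y' => D * (1 + @basisConst ι _ (Matrix mm mm ℂ) Matrix.frobeniusNormedAddCommGroup Matrix.frobeniusNormedSpace e * Fintype.card mm * ((2 * ((d + 1 : ℕ) : ℝ) + 4) * (((C₁ / ξ ^ 3) + (C / ξ ^ 2) ^ 2) * Real.exp (5 * (C / ξ))) + 2 * ((d + 1 : ℕ) : ℝ) * ((C / ξ ^ 2) ^ 2 * Real.exp (2 * (C / ξ))) + 8 * ((C / ξ) * (C / ξ ^ 2) * Real.exp (2 * (C / ξ))))) * ((L : ℝ) ^ kk) ^ (-(1 / 4 : ℝ)) * Real.exp (-(δ / 16 * (unitTorusGeo L kk (cvM d L mv kk hL)).dist y y')))) := by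
  obtain ⟨δ, w₀, c₀, D, hδ, hc₀, H⟩ := uN_idef_scGreen_tr_of_reg335Lip_small_explicit (d := d) hL hL7 ha₀ ι
  have hLpos : 0 < L := (by have := hL.2; omega)
  have hL1r : (1 : ℝ) < (L : ℝ) := by exact_mod_cast hL.2
  refine ⟨δ, w₀, c₀, max D 0, hδ, hc₀, le_max_right _ _, fun mv kk r hk hr hw₀ => ?_⟩
  intro mm _ _ _ e he U' hU'g Q ξ C C₁ hξ hC hC₁ hsmall h335 hQ
  obtain ⟨u', hu', hmain⟩ := H mv kk r hk hr hw₀ e he U' hU'g Q ξ C C₁ hξ hC hC₁ hsmall h335 hQ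
  refine ⟨u', hu', hmain.mono fun y y' => ?_⟩
  have hκ := @basisConst_nonneg ι _ (Matrix mm mm ℂ) Matrix.frobeniusNormedAddCommGroup Matrix.frobeniusNormedSpace e
  have hx1 : (1 : ℝ) ≤ (L : ℝ) ^ kk := one_le_pow₀ hL1r.le
  have hηx : ((((L ^ kk : ℕ) : ℝ))⁻¹) ≤ ((L : ℝ) ^ kk) ^ (-(1 / 4 : ℝ)) := by rw [Nat.cast_pow]; exact (inv_le_rpow_neg_quarter hx1).1
  have hx0 : (0 : ℝ) ≤ ((L : ℝ) ^ kk) ^ (-(1 / 4 : ℝ)) := by positivity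
  have hoB := divergenceFit_bookkeeping (@basisConst ι _ (Matrix mm mm ℂ) Matrix.frobeniusNormedAddCommGroup Matrix.frobeniusNormedSpace e) (Fintype.card mm : ℝ) ((d + 1 : ℕ) : ℝ) ((L ^ r : ℕ) : ℝ) ((L ^ r - 1 : ℕ) : ℝ) ((L ^ kk : ℕ) : ℝ) ((L ^ r * L ^ kk : ℕ) : ℝ)
    ((((L ^ kk : ℕ) : ℝ))⁻¹) (((((L ^ r * L ^ kk : ℕ) : ℝ))⁻¹)) (((C / ξ) * Real.exp (((((L ^ r * L ^ kk : ℕ) : ℝ))⁻¹) * (C / ξ)))) (((C / ξ ^ 2) * Real.exp (((((L ^ r * L ^ kk : ℕ) : ℝ))⁻¹) * (C / ξ)))) ((((C₁ / ξ ^ 3) + ((((L ^ r * L ^ kk : ℕ) : ℝ))⁻¹) * (C / ξ ^ 2) ^ 2) * Real.exp (5 * (((((L ^ r * L ^ kk : ℕ) : ℝ))⁻¹) * (C / ξ))))) C C₁ ξ hκ (Nat.cast_nonneg _) (Nat.cast_nonneg _)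
    (by exact_mod_cast Nat.one_le_pow _ _ hLpos) (by exact_mod_cast Nat.sub_le _ _) (by exact_mod_cast Nat.one_le_pow _ _ hLpos) (by rw [Nat.cast_mul]) rfl rfl hξ hC hC₁ rfl rfl rfl
  set R : ℝ := ((2 * ((d + 1 : ℕ) : ℝ) + 4) * (((C₁ / ξ ^ 3) + (C / ξ ^ 2) ^ 2) * Real.exp (5 * (C / ξ))) + 2 * ((d + 1 : ℕ) : ℝ) * ((C / ξ ^ 2) ^ 2 * Real.exp (2 * (C / ξ))) + 8 * ((C / ξ) * (C / ξ ^ 2) * Real.exp (2 * (C / ξ)))) with hR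
  have hR0 : 0 ≤ R := by rw [hR]; positivity
  set x14 : ℝ := ((L : ℝ) ^ kk) ^ (-(1 / 4 : ℝ)) with hx14
  have hoB0 : (0 : ℝ) ≤ (@basisConst ι _ (Matrix mm mm ℂ) Matrix.frobeniusNormedAddCommGroup Matrix.frobeniusNormedSpace e * (((L ^ r * L ^ kk : ℕ) : ℝ) ^ 2 * (((d + 1 : ℕ) : ℝ) * (((L ^ r - 1 : ℕ) : ℝ) * (Fintype.card mm * (2 * (((((L ^ r * L ^ kk : ℕ) : ℝ))⁻¹) ^ 3 * (((C₁ / ξ ^ 3) + ((((L ^ r * L ^ kk : ℕ) : ℝ))⁻¹) * (C / ξ ^ 2) ^ 2) * Real.exp (5 * (((((L ^ r * L ^ kk : ℕ) : ℝ))⁻¹) * (C / ξ))))) + ((((L ^ r * L ^ kk : ℕ) : ℝ))⁻¹) ^ 2 * ((C / ξ ^ 2) * Real.exp (((((L ^ r * L ^ kk : ℕ) : ℝ))⁻¹) * (C / ξ))) * (((((L ^ r * L ^ kk : ℕ) : ℝ))⁻¹) ^ 2 * ((C / ξ ^ 2) * Real.exp (((((L ^ r * L ^ kk : ℕ) : ℝ))⁻¹)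 * (C / ξ)))) + ((((L ^ r * L ^ kk : ℕ) : ℝ))⁻¹) ^ 2 * ((C / ξ ^ 2) * Real.exp (((((L ^ r * L ^ kk : ℕ) : ℝ))⁻¹) * (C / ξ))) * (((((L ^ r * L ^ kk : ℕ) : ℝ))⁻¹) ^ 2 * ((C / ξ ^ 2) * Real.exp (((((L ^ r * L ^ kk : ℕ) : ℝ))⁻¹) * (C / ξ)))))))) + Fintype.card mm * (4 * ((L ^ kk : ℕ) : ℝ) ^ 2 * ((L ^ r : ℕ) : ℝ) ^ 3 * (((((L ^ r * L ^ kk : ℕ) : ℝ))⁻¹) * ((C / ξ) * Real.exp (((((L ^ r * L ^ kk : ℕ) : ℝ))⁻¹) * (C / ξ))) * (((((L ^ r * L ^ kk : ℕ) : ℝ))⁻¹) ^ 2 * ((C / ξ ^ 2) * Real.exp (((((L ^ r * L ^ kk : ℕ) : ℝ))⁻¹) * (C / ξ)))) + ((((L ^ r * L ^ kk : ℕ) : ℝ))⁻¹) ^ 3 * (((C₁ / ξ ^ 3) + ((((L ^ r * L ^ kk : ℕ) : ℝ))⁻¹) * (C / ξ ^ 2) ^ 2) * Real.exp (5 * (((((L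 ^ r * L ^ kk : ℕ) : ℝ))⁻¹) * (C / ξ))))) + 2 * (((L ^ r : ℕ) : ℝ) * ((L ^ kk : ℕ) : ℝ)) ^ 2 * ((((L ^ r : ℕ) : ℝ) + 1) * (((((L ^ r * L ^ kk : ℕ) : ℝ))⁻¹) * ((C / ξ) * Real.exp (((((L ^ r * L ^ kk : ℕ) : ℝ))⁻¹) * (C / ξ)))) * (((((L ^ r * L ^ kk : ℕ) : ℝ))⁻¹) ^ 2 * ((C / ξ ^ 2) * Real.exp (((((L ^ r * L ^ kk : ℕ) : ℝ))⁻¹) * (C / ξ)))))))) := by positivity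
  have h2 : (@basisConst ι _ (Matrix mm mm ℂ) Matrix.frobeniusNormedAddCommGroup Matrix.frobeniusNormedSpace e * (((L ^ r * L ^ kk : ℕ) : ℝ) ^ 2 * (((d + 1 : ℕ) : ℝ) * (((L ^ r - 1 : ℕ) : ℝ) * (Fintype.card mm * (2 * (((((L ^ r * L ^ kk : ℕ) : ℝ))⁻¹) ^ 3 * (((C₁ / ξ ^ 3) + ((((L ^ r * L ^ kk : ℕ) : ℝ))⁻¹) * (C / ξ ^ 2) ^ 2) * Real.exp (5 * (((((L ^ r * L ^ kk : ℕ) : ℝ))⁻¹) * (C / ξ))))) + ((((L ^ r * L ^ kk : ℕ) : ℝ))⁻¹) ^ 2 * ((C / ξ ^ 2) * Real.exp (((((L ^ r * L ^ kk : ℕ) : ℝ))⁻¹) * (C / ξ))) * (((((L ^ r * L ^ kk : ℕ) : ℝ))⁻¹) ^ 2 * ((C / ξ ^ 2) * Real.exp (((((L ^ r * L ^ kk : ℕ) : ℝ))⁻¹) * (C / ξ)))) + ((((L ^ r * L ^ kk : ℕ) : ℝ))⁻¹) ^ 2 * ((C / ξ ^ 2) * Real.exp (((((L ^ r * L ^ kk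 : ℕ) : ℝ))⁻¹) * (C / ξ))) * (((((L ^ r * L ^ kk : ℕ) : ℝ))⁻¹) ^ 2 * ((C / ξ ^ 2) * Real.exp (((((L ^ r * L ^ kk : ℕ) : ℝ))⁻¹) * (C / ξ)))))))) + Fintype.card mm * (4 * ((L ^ kk : ℕ) : ℝ) ^ 2 * ((L ^ r : ℕ) : ℝ) ^ 3 * (((((L ^ r * L ^ kk : ℕ) : ℝ))⁻¹) * ((C / ξ) * Real.exp (((((L ^ r * L ^ kk : ℕ) : ℝ))⁻¹) * (C / ξ))) * (((((L ^ r * L ^ kk : ℕ) : ℝ))⁻¹) ^ 2 * ((C / ξ ^ 2) * Real.exp (((((L ^ r * L ^ kk : ℕ) : ℝ))⁻¹) * (C / ξ)))) + ((((L ^ r * L ^ kk : ℕ) : ℝ))⁻¹) ^ 3 * (((C₁ / ξ ^ 3) + ((((L ^ r * L ^ kk : ℕ) : ℝ))⁻¹) * (C / ξ ^ 2) ^ 2) * Real.exp (5 * (((((L ^ r * L ^ kk : ℕ) : ℝ))⁻¹) * (C / ξ))))) + 2 * (((L ^ r : ℕ) : ℝ) * ((L ^ kk : ℕ) : ℝ))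 ^ 2 * ((((L ^ r : ℕ) : ℝ) + 1) * (((((L ^ r * L ^ kk : ℕ) : ℝ))⁻¹) * ((C / ξ) * Real.exp (((((L ^ r * L ^ kk : ℕ) : ℝ))⁻¹) * (C / ξ)))) * (((((L ^ r * L ^ kk : ℕ) : ℝ))⁻¹) ^ 2 * ((C / ξ ^ 2) * Real.exp (((((L ^ r * L ^ kk : ℕ) : ℝ))⁻¹) * (C / ξ)))))))) ≤ @basisConst ι _ (Matrix mm mm ℂ) Matrix.frobeniusNormedAddCommGroup Matrix.frobeniusNormedSpace e * Fintype.card mm * R * x14 :=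
    hoB.trans (by calc @basisConst ι _ (Matrix mm mm ℂ) Matrix.frobeniusNormedAddCommGroup Matrix.frobeniusNormedSpace e * (Fintype.card mm : ℝ) * ((((L ^ kk : ℕ) : ℝ))⁻¹) * R = @basisConst ι _ (Matrix mm mm ℂ) Matrix.frobeniusNormedAddCommGroup Matrix.frobeniusNormedSpace e * Fintype.card mm * R * ((((L ^ kk : ℕ) : ℝ))⁻¹) := by ring
      _ ≤ @basisConst ι _ (Matrix mm mm ℂ) Matrix.frobeniusNormedAddCommGroup Matrix.frobeniusNormedSpace e * Fintype.card mm * R * x14 := mul_le_mul_of_nonneg_left hηx (by positivity))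
  have hD0 : 0 ≤ max D 0 := le_max_right _ _
  calc D * (x14 + (@basisConst ι _ (Matrix mm mm ℂ) Matrix.frobeniusNormedAddCommGroup Matrix.frobeniusNormedSpace e * (((L ^ r * L ^ kk : ℕ) : ℝ) ^ 2 * (((d + 1 : ℕ) : ℝ) * (((L ^ r - 1 : ℕ) : ℝ) * (Fintype.card mm * (2 * (((((L ^ r * L ^ kk : ℕ) : ℝ))⁻¹) ^ 3 * (((C₁ / ξ ^ 3) + ((((L ^ r * L ^ kk : ℕ) : ℝ))⁻¹) * (C / ξ ^ 2) ^ 2) * Real.exp (5 * (((((L ^ r * L ^ kk : ℕ) : ℝ))⁻¹) * (C / ξ))))) + ((((L ^ r * L ^ kk : ℕ) : ℝ))⁻¹) ^ 2 * ((C / ξ ^ 2) * Real.exp (((((L ^ r * L ^ kk : ℕ) : ℝ))⁻¹) * (C / ξ))) * (((((L ^ r * L ^ kk : ℕ) : ℝ))⁻¹) ^ 2 * ((C / ξ ^ 2) * Real.exp (((((L ^ r * L ^ kk : ℕ) : ℝ))⁻¹) * (C / ξ)))) + ((((L ^ r * L ^ kk : ℕ) : ℝ))⁻¹) ^ 2 *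 ((C / ξ ^ 2) * Real.exp (((((L ^ r * L ^ kk : ℕ) : ℝ))⁻¹) * (C / ξ))) * (((((L ^ r * L ^ kk : ℕ) : ℝ))⁻¹) ^ 2 * ((C / ξ ^ 2) * Real.exp (((((L ^ r * L ^ kk : ℕ) : ℝ))⁻¹) * (C / ξ)))))))) + Fintype.card mm * (4 * ((L ^ kk : ℕ) : ℝ) ^ 2 * ((L ^ r : ℕ) : ℝ) ^ 3 * (((((L ^ r * L ^ kk : ℕ) : ℝ))⁻¹) * ((C / ξ) * Real.exp (((((L ^ r * L ^ kk : ℕ) : ℝ))⁻¹) * (C / ξ))) * (((((L ^ r * L ^ kk : ℕ) : ℝ))⁻¹) ^ 2 * ((C / ξ ^ 2) * Real.exp (((((L ^ r * L ^ kk : ℕ) : ℝ))⁻¹) * (C / ξ)))) + ((((L ^ r * L ^ kk : ℕ) : ℝ))⁻¹) ^ 3 * (((C₁ / ξ ^ 3) + ((((L ^ r * L ^ kk : ℕ) : ℝ))⁻¹) * (C / ξ ^ 2) ^ 2) * Real.exp (5 * (((((L ^ r * L ^ kk : ℕ) : ℝ))⁻¹) * (C / ξ))))) + 2 * (((L ^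 r : ℕ) : ℝ) * ((L ^ kk : ℕ) : ℝ)) ^ 2 * ((((L ^ r : ℕ) : ℝ) + 1) * (((((L ^ r * L ^ kk : ℕ) : ℝ))⁻¹) * ((C / ξ) * Real.exp (((((L ^ r * L ^ kk : ℕ) : ℝ))⁻¹) * (C / ξ)))) * (((((L ^ r * L ^ kk : ℕ) : ℝ))⁻¹) ^ 2 * ((C / ξ ^ 2) * Real.exp (((((L ^ r * L ^ kk : ℕ) : ℝ))⁻¹) * (C / ξ))))))))) * Real.exp (-(δ / 16 * (unitTorusGeo L kk (cvM d L mv kk hL)).dist y y'))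
      ≤ max D 0 * (x14 + (@basisConst ι _ (Matrix mm mm ℂ) Matrix.frobeniusNormedAddCommGroup Matrix.frobeniusNormedSpace e * (((L ^ r * L ^ kk : ℕ) : ℝ) ^ 2 * (((d + 1 : ℕ) : ℝ) * (((L ^ r - 1 : ℕ) : ℝ) * (Fintype.card mm * (2 * (((((L ^ r * L ^ kk : ℕ) : ℝ))⁻¹) ^ 3 * (((C₁ / ξ ^ 3) + ((((L ^ r * L ^ kk : ℕ) : ℝ))⁻¹) * (C / ξ ^ 2) ^ 2) * Real.exp (5 * (((((L ^ r * L ^ kk : ℕ) : ℝ))⁻¹) * (C / ξ))))) + ((((L ^ r * L ^ kk : ℕ) : ℝ))⁻¹) ^ 2 * ((C / ξ ^ 2) * Real.exp (((((L ^ r * L ^ kk : ℕ) : ℝ))⁻¹) * (C / ξ))) * (((((L ^ r * L ^ kk : ℕ) : ℝ))⁻¹) ^ 2 * ((C / ξ ^ 2) * Real.exp (((((L ^ r * L ^ kk : ℕ) : ℝ))⁻¹) * (C / ξ)))) + ((((L ^ r * L ^ kk : ℕ) : ℝ))⁻¹) ^ 2 * ((C / ξ ^ 2) * Real.exp (((((L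 ^ r * L ^ kk : ℕ) : ℝ))⁻¹) * (C / ξ))) * (((((L ^ r * L ^ kk : ℕ) : ℝ))⁻¹) ^ 2 * ((C / ξ ^ 2) * Real.exp (((((L ^ r * L ^ kk : ℕ) : ℝ))⁻¹) * (C / ξ)))))))) + Fintype.card mm * (4 * ((L ^ kk : ℕ) : ℝ) ^ 2 * ((L ^ r : ℕ) : ℝ) ^ 3 * (((((L ^ r * L ^ kk : ℕ) : ℝ))⁻¹) * ((C / ξ) * Real.exp (((((L ^ r * L ^ kk : ℕ) : ℝ))⁻¹) * (C / ξ))) * (((((L ^ r * L ^ kk : ℕ) : ℝ))⁻¹) ^ 2 * ((C / ξ ^ 2) * Real.exp (((((L ^ r * L ^ kk : ℕ) : ℝ))⁻¹) * (C / ξ)))) + ((((L ^ r * L ^ kk : ℕ) : ℝ))⁻¹) ^ 3 * (((C₁ / ξ ^ 3) + ((((L ^ r * L ^ kk : ℕ) : ℝ))⁻¹) * (C / ξ ^ 2) ^ 2) * Real.exp (5 * (((((L ^ r * L ^ kk : ℕ) : ℝ))⁻¹) * (C / ξ))))) + 2 * (((L ^ r : ℕ) : ℝ) * ((L ^ kk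 : ℕ) : ℝ)) ^ 2 * ((((L ^ r : ℕ) : ℝ) + 1) * (((((L ^ r * L ^ kk : ℕ) : ℝ))⁻¹) * ((C / ξ) * Real.exp (((((L ^ r * L ^ kk : ℕ) : ℝ))⁻¹) * (C / ξ)))) * (((((L ^ r * L ^ kk : ℕ) : ℝ))⁻¹) ^ 2 * ((C / ξ ^ 2) * Real.exp (((((L ^ r * L ^ kk : ℕ) : ℝ))⁻¹) * (C / ξ))))))))) * Real.exp (-(δ / 16 * (unitTorusGeo L kk (cvM d L mv kk hL)).dist y y')) :=
        mul_le_mul_of_nonneg_right (mul_le_mul_of_nonneg_right (le_max_left _ _) (add_nonneg hx0 hoB0)) (Real.exp_pos _).le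
    _ ≤ max D 0 * (x14 + @basisConst ι _ (Matrix mm mm ℂ) Matrix.frobeniusNormedAddCommGroup Matrix.frobeniusNormedSpace e * Fintype.card mm * R * x14) * Real.exp (-(δ / 16 * (unitTorusGeo L kk (cvM d L mv kk hL)).dist y y')) :=
        mul_le_mul_of_nonneg_right (mul_le_mul_of_nonneg_left (add_le_add le_rfl h2) hD0) (Real.exp_pos _).le
    _ = max D 0 * (1 + @basisConst ι _ (Matrix mm mm ℂ) Matrix.frobeniusNormedAddCommGroup Matrix.frobeniusNormedSpace e * Fintype.card mm * R) * x14 * Real.exp (-(δ / 16 * (unitTorusGeo L kk (cvM d L mv kk hL)).dist y y')) := by ring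

end Rate

end Summit.QuantumFields.YangMills.BalabanUVNodes.N15.Gluing

end
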